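import Literature.NumberTheory.Automorphic.Liu2021.NablaBaseChangeCover
import Literature.NumberTheory.Automorphic.Liu2021.AppendixC.AlbaneseMapEpi
import Literature.NumberTheory.Automorphic.Liu2021.AppendixC.NablaSmooth
import HarnessLib

/-!
# Liu 2021 §2.1 / §4.2: `∇u` hits every complex point of `∇X` when same-piece pairs of complex points lift along `u`

[Liu2021] = Yifeng Liu, *Fourier–Jacobi cycles and arithmetic relative trace formula*, Camb. J. Math. **9** (2021) =
arXiv:2102.11518 (`FJcycle.tex` line numbers as in `Liu2021/AppendixC/Glue.lean`).  PROOF FILE (theorems only; no definition,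
no named fact, no instance, no `sorry`) over the carriers `AppendixC.Nabla` (Def. 2.1 (1): «the smallest open and closed subscheme of
`X × X` containing the diagonal `ΔX`») and the §4.2 datum `AppendixC.Sec42Data` (fields `nablaTr`, `Atr`).

## What is proved

Let `k` be a field of characteristic zero with `[Algebra k ℂ]`, `u : Y → X` a morphism of `k`-schemes with `X` smooth and projective,
`N = ∇X`, `N' = ∇Y` ANY carriers and `ν : ∇Y → ∇X` the restriction of `u × u` (`ν ≫ incl = incl ≫ (u ⊗ u)`; e.g. `Nabla.map`, or the
field `Sec42Data.nablaTr`).  Let `inj_c : P_c → X_ℂ` be a colimit cofan of geometrically irreducible complex varieties and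
`inj'_{c'} : P'_{c'} → Y_ℂ` ANY family of geometrically irreducible complex varieties mapping to `Y_ℂ`.

* `Nabla.range_tensorHom_μ_subset_range_map_incl` — `P' × P' → (Y × Y)_ℂ` lands in `(∇Y)_ℂ` (the image of the irreducible
  `P' × P'` is preconnected and meets the open and closed `(∇Y)_ℂ` on the diagonal; cf. `NablaOfPieces.range_tensorHom_subset_range_incl`,
  here for the BASE CHANGE of a `∇Y` over `k`, which need not be a `∇(Y_ℂ)`).
* `Nabla.exists_comp_eq_of_pieces_lift` — **if every pair of complex points of a piece `P_c` lifts along `u` to a pair of complex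
  points of one piece `P'_{c'}` (`hlift`), then every `ℂ`-point of `∇X` over `k` lifts along `ν` to a `ℂ`-point of `∇Y`.**  Proof: a
  `ℂ`-point of `∇X` is a pair of `ℂ`-points of `X` read in `(X × X)_ℂ ≅ X_ℂ × X_ℂ`; by the tree's
  `Nabla.exists_mem_range_tensorHom_baseChange_complex` (`Liu2021/NablaBaseChangeCover`: finite Galois splitting, `∇`-descent,
  connectedness of the complexified pieces) both coordinates lie in ONE piece `P_c`; lift them (`hlift`) to one piece `P'_{c'}`; the
  lifted pair lies in `(∇Y)_ℂ` by the first bullet, i.e. is a `ℂ`-point of `∇Y`, and `ν` maps it to the given point because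
  `∇X ↪ X × X` is a monomorphism.
* `Sec42Data.epi_Atr_of_pieces_lift` — for a §4.2 datum `C` (Liu's tower `X_K = S̃h(𝕍)_K`, `A_K = Alb X_K`, l. 2060–2072) and
  `f : K' ⟶ K`: the same lifting hypothesis for the complex pieces of `X_K`, `X_{K'}` along `u^{K'}_K` makes `Alb_{u^{K'}_K} = C.Atr f` an
  EPIMORPHISM of abelian varieties (with `Sec42Data.epi_Atr_of_nablaTr_surjective_algPoints`, `AlbaneseMapEpi.lean`, and the
  smoothness instances of `NablaSmooth.lean`).

Use (cell `hodgecm-mathlib`, row VI-3 `AlbTransitionEpi`, stub (I) `stub_albTransitionEpi` of `Lines/a3-liu418.lean`): the record of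
Deligne's canonical models supplies the pieces (`RecordSystem.pieces`: ball quotients `Γ_{g_q} \ 𝔹²` uniformised by `z ↦ [z, g_q K]`)
and the lifting (`RecordSystem.map_pts`: `[z, aK'] ↦ [z, aK]`), whence input (I) of [Liu2021, Thm. 4.18 (1)].  HC_CM is NOT proved
here; nothing in this file refers to Shimura varieties.

## References

* [Liu2021] Y. Liu, arXiv:2102.11518 = Camb. J. Math. 9 (2021): §2.1 Def. 2.1 (1) (l. 1171–1176), proof of the Proposition
  (l. 1194–1200), Def. 2.3 (l. 1202–1208), §4.2 l. 2060–2072, proof of Thm. 4.18 (1) (l. 2247–2282).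
* [GortzWedhorn2020] U. Görtz, T. Wedhorn, *Algebraic Geometry I*, 2nd ed. (2020): Prop. 4.16 (base change), Prop. 5.50 (ii).
-/

set_option autoImplicit false

noncomputable section

open CategoryTheory CategoryTheory.Limits AlgebraicGeometry MonoidalCategory CartesianMonoidalCategory
open Literature.AlgebraicGeometry.Motives
open scoped MonObj

namespace Literature.NumberTheory.Automorphic.Liu2021.AppendixC

namespace Nabla

open AbelianVariety (bcSpec bcFunctor)

set_option backward.isDefEq.respectTransparency false

section Complex

variable {k : Type} [Field k] [Algebra k ℂ]

/-! ## §0 Points: lifting through open immersions, base change of `ℂ`-points -/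

/-- An `L`-point of `X` over `k` whose underlying point lies in the image of an open immersion `g : W → X` over `k` lifts along `g`:
an `L`-point is a point `x` with an embedding `κ(x) → L` (Hartshorne II Ex. 2.7), and the open subscheme `W ⊇ {x}` has the same residue
field (Mathlib `IsOpenImmersion.lift` on the one-point scheme `Spec L`). [cite: Hartshorne1977, II Ex. 2.7] -/
theorem _root_.Literature.AlgebraicGeometry.Motives.AlgPoints.exists_comp_eq_of_pt_mem_range {K : Type} [Field K]
    {L : Type} [Field L] [Algebra K L] {W Z : SchemeOver K} (g : W ⟶ Z) [IsOpenImmersion g.left] (P : AlgPoints Z L)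
    (h : P.pt ∈ Set.range ⇑g.left) : ∃ Q : AlgPoints W L, Q ≫ g = P := by
  have hsub : Set.range ⇑P.left ⊆ Set.range ⇑g.left := by
    rintro _ ⟨x, rfl⟩
    obtain rfl : x = IsLocalRing.closedPoint L := Subsingleton.elim (α := ↥(Spec (CommRingCat.of L))) _ _
    exact h
  refine ⟨Over.homMk (IsOpenImmersion.lift g.left P.left hsub) ?_, ?_⟩
  · rw [← Over.w g, ← Category.assoc, IsOpenImmersion.lift_fac]
    exact Over.w P
  · exact Over.OverMorphism.ext (IsOpenImmersion.lift_fac _ _ _)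

/-- `X(ℂ) ⥲ X_ℂ(ℂ)` (`AlgPoints.baseChangeEquiv`) is natural in the `k`-scheme `X`: it carries `P ≫ g` to `P_ℂ ≫ g_ℂ`
(universal property of the fibre product; Görtz–Wedhorn I, Prop. 4.16). [cite: GortzWedhorn2020, Prop. 4.16] -/
theorem _root_.Literature.AlgebraicGeometry.Motives.AlgPoints.baseChangeEquiv_comp {Z W : SchemeOver k} (g : Z ⟶ W)
    (P : AlgPoints Z ℂ) :
    AlgPoints.baseChangeEquiv (algebraMap k ℂ) W (P ≫ g) =
      AlgPoints.baseChangeEquiv (algebraMap k ℂ) Z P ≫ (bcFunctor k ℂ).map g := by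
  rw [Equiv.apply_eq_iff_eq_symm_apply]
  apply Over.OverMorphism.ext
  rw [AlgPoints.baseChangeEquiv_symm_apply_left, Over.comp_left, Over.comp_left, Category.assoc]
  erw [baseChangeHom_map_left_comp_fst]
  rw [← Category.assoc, AlgPoints.baseChangeEquiv_apply_left_comp_fst]

/-- The underlying point of `(P ≫ g)_ℂ` is `g_ℂ` of the underlying point of `P_ℂ`. [cite: GortzWedhorn2020, Prop. 4.16] -/
theorem _root_.Literature.AlgebraicGeometry.Motives.AlgPoints.pt_baseChangeEquiv_comp {Z W : SchemeOver k} (g : Z ⟶ W)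
    (P : AlgPoints Z ℂ) :
    (AlgPoints.baseChangeEquiv (algebraMap k ℂ) W (P ≫ g)).pt =
      ((bcFunctor k ℂ).map g).left (AlgPoints.baseChangeEquiv (algebraMap k ℂ) Z P).pt := by
  rw [AlgPoints.baseChangeEquiv_comp]
  rfl

/-! ## §1 The image of `(f × g) ≫ μ : P × P' → (X × X)_ℂ` -/

/-- The image of `(f × g) ≫ μ : P × P' → (X × X)_ℂ` (`μ : X_ℂ × X_ℂ ⥲ (X × X)_ℂ` the monoidal structure isomorphism of base change,
`f : P → X_ℂ`, `g : P' → X_ℂ`) consists of the points whose two projections `(pr_i)_ℂ` lie in the images of `f` and `g` (Mathlib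
`Scheme.Pullback.range_map`, `Functor.Monoidal.μ_fst ∕ μ_snd`; same statement as the private lemma of `Liu2021/NablaBaseChangeCover`).
[folklore] -/
private theorem mem_range_tensorHom_μ_iff' {X : SchemeOver k} {P P' : SchemeOver ℂ}
    (f : P ⟶ (bcFunctor k ℂ).obj X) (g : P' ⟶ (bcFunctor k ℂ).obj X) (w : ↥((bcFunctor k ℂ).obj (X ⊗ X)).left) :
    w ∈ Set.range ⇑((f ⊗ₘ g) ≫ Functor.LaxMonoidal.μ (bcFunctor k ℂ) X X).left ↔
      ((bcFunctor k ℂ).map (fst X X)).left w ∈ Set.range ⇑f.left ∧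
        ((bcFunctor k ℂ).map (snd X X)).left w ∈ Set.range ⇑g.left := by
  have h1 : ∀ v, ((bcFunctor k ℂ).map (fst X X)).left ((Functor.LaxMonoidal.μ (bcFunctor k ℂ) X X).left v) =
      (fst ((bcFunctor k ℂ).obj X) ((bcFunctor k ℂ).obj X)).left v := fun v => by
    rw [← Scheme.Hom.comp_apply, ← Over.comp_left, Functor.Monoidal.μ_fst]
  have h2 : ∀ v, ((bcFunctor k ℂ).map (snd X X)).left ((Functor.LaxMonoidal.μ (bcFunctor k ℂ) X X).left v) =
      (snd ((bcFunctor k ℂ).obj X) ((bcFunctor k ℂ).obj X)).left v := fun v => by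
    rw [← Scheme.Hom.comp_apply, ← Over.comp_left, Functor.Monoidal.μ_snd]
  have hrange : Set.range ⇑(f ⊗ₘ g).left =
      ⇑(fst ((bcFunctor k ℂ).obj X) ((bcFunctor k ℂ).obj X)).left ⁻¹' Set.range ⇑f.left ∩
        ⇑(snd ((bcFunctor k ℂ).obj X) ((bcFunctor k ℂ).obj X)).left ⁻¹' Set.range ⇑g.left := by
    rw [Over.tensorHom_left]
    exact Scheme.Pullback.range_map _ _ _ _ _ _ _ _ _
  have hv : (Functor.LaxMonoidal.μ (bcFunctor k ℂ) X X).left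
      ((Functor.OplaxMonoidal.δ (bcFunctor k ℂ) X X).left w) = w := by
    rw [← Scheme.Hom.comp_apply, ← Over.comp_left, Functor.Monoidal.δ_μ, Over.id_left]; rfl
  have hinj : Function.Injective ⇑(Functor.LaxMonoidal.μ (bcFunctor k ℂ) X X).left := fun a b hab => by
    have := congrArg (fun t => (Functor.OplaxMonoidal.δ (bcFunctor k ℂ) X X).left t) hab
    simp only [← Scheme.Hom.comp_apply, ← Over.comp_left, Functor.Monoidal.μ_δ, Over.id_left] at this
    exact this
  rw [← hv, h1, h2]
  constructor
  · rintro ⟨y, hy⟩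
    rw [Over.comp_left, Scheme.Hom.comp_apply] at hy
    have hmem : (Functor.OplaxMonoidal.δ (bcFunctor k ℂ) X X).left w ∈ Set.range ⇑(f ⊗ₘ g).left := ⟨y, hinj hy⟩
    rw [hrange] at hmem
    exact hmem
  · rintro ⟨ha, hb⟩
    have hmem : (Functor.OplaxMonoidal.δ (bcFunctor k ℂ) X X).left w ∈ Set.range ⇑(f ⊗ₘ g).left := by
      rw [hrange]; exact ⟨ha, hb⟩
    obtain ⟨y, hy⟩ := hmem
    exact ⟨y, by rw [Over.comp_left, Scheme.Hom.comp_apply, hy]⟩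

/-! ## §2 `P' × P' → (Y × Y)_ℂ` lands in `(∇Y)_ℂ` for `P'` geometrically irreducible -/

/-- **The self-product of a geometrically irreducible complex variety over `Y_ℂ` lands in `(∇Y)_ℂ`.**  For `i : P' → Y_ℂ` with `P'`
geometrically irreducible over `ℂ` and ANY `∇Y` over `k` (Def. 2.1 (1)), the image of `(i × i) ≫ μ : P' × P' → (Y × Y)_ℂ` is contained
in the image of the base-changed inclusion `(∇Y)_ℂ ↪ (Y × Y)_ℂ`: it is preconnected (continuous image of the irreducible `P' ×_ℂ P'`),
meets `(∇Y)_ℂ` (on the base-changed diagonal through a point of `P'`), and `(∇Y)_ℂ` is open and closed (base change of an open and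
closed immersion).  Ours; the component-wise reading of «`∇_{k'}X'`» in the proof of the Proposition (l. 1194–1200), for the base
change to `ℂ`. [cite: Liu2021, §2.1 Def. 2.1 (1) (l. 1171–1174) and proof of the Proposition (l. 1194–1200)]
[cite: GortzWedhorn2020, Prop. 5.50 (ii)] -/
theorem range_tensorHom_μ_subset_range_map_incl {Y : SchemeOver k} (N' : Nabla Y) {P' : SchemeOver ℂ}
    (i : P' ⟶ (bcFunctor k ℂ).obj Y) [GeometricallyIrreducible P'.hom] :
    Set.range ⇑((i ⊗ₘ i) ≫ Functor.LaxMonoidal.μ (bcFunctor k ℂ) Y Y).left ⊆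
      Set.range ⇑((bcFunctor k ℂ).map N'.incl).left := by
  haveI : IsOpenImmersion N'.incl.left := N'.isOpenImmersion_incl
  haveI : IsClosedImmersion N'.incl.left := N'.isClosedImmersion_incl
  haveI := GaloisDescent.isOpenImmersion_bcFunctor_map_left ℂ N'.incl
  haveI := GaloisDescent.isClosedImmersion_bcFunctor_map_left ℂ N'.incl
  haveI : IrreducibleSpace ↥P'.left := GeometricallyIrreducible.irreducibleSpace_of_subsingleton P'.hom
  haveI : IrreducibleSpace ↥(P' ⊗ P').left := by
    change IrreducibleSpace ↥(pullback P'.hom P'.hom)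
    infer_instance
  have hpre : _root_.IsPreconnected (Set.range ⇑((i ⊗ₘ i) ≫ Functor.LaxMonoidal.μ (bcFunctor k ℂ) Y Y).left) :=
    isPreconnected_range (Scheme.Hom.continuous _)
  have hT : IsClopen (Set.range ⇑((bcFunctor k ℂ).map N'.incl).left) :=
    ⟨((bcFunctor k ℂ).map N'.incl).left.isClosedEmbedding.isClosed_range,
      IsOpenImmersion.isOpen_range ((bcFunctor k ℂ).map N'.incl).left⟩
  obtain ⟨y⟩ := (inferInstance : Nonempty ↥P'.left)
  -- the point `(i y, i y)` of `(Y × Y)_ℂ` lies in the image of `P' × P'` and in `(∇Y)_ℂ`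
  have key : (lift (𝟙 P') (𝟙 P') ≫ (i ⊗ₘ i) ≫ Functor.LaxMonoidal.μ (bcFunctor k ℂ) Y Y) =
      i ≫ (bcFunctor k ℂ).map N'.diag ≫ (bcFunctor k ℂ).map N'.incl := by
    rw [← Functor.map_comp, N'.diag_incl, ← Functor.Monoidal.lift_μ, CategoryTheory.Functor.map_id, ← Category.assoc,
      lift_map, Category.id_comp, ← Category.assoc, comp_lift, Category.comp_id]
  refine hpre.subset_isClopen hT ⟨((i ⊗ₘ i) ≫ Functor.LaxMonoidal.μ (bcFunctor k ℂ) Y Y).left ((lift (𝟙 P') (𝟙 P')).left y),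
    ⟨_, rfl⟩, ?_⟩
  refine ⟨((bcFunctor k ℂ).map N'.diag).left (i.left y), ?_⟩
  rw [← Scheme.Hom.comp_apply, ← Scheme.Hom.comp_apply, ← Scheme.Hom.comp_apply, ← Over.comp_left, ← Over.comp_left,
    ← Over.comp_left, key]

/-! ## §3 `∇u` hits every `ℂ`-point of `∇X` when same-piece pairs lift -/

/-- **Every `ℂ`-point of `∇X` lifts along `∇u` when same-piece pairs of complex points lift along `u`.**  Data: `k` of characteristic
zero with `[Algebra k ℂ]`; `u : Y → X` over `k` with `X` smooth of relative dimension `d` and projective; ANY carriers `N = ∇X`,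
`N' = ∇Y` and `ν : ∇Y → ∇X` with `ν ≫ (∇X ↪ X × X) = (∇Y ↪ Y × Y) ≫ (u × u)` (Def. 2.1 (1), l. 1176: «`u × u` restricts to a morphism
`∇u : ∇Y → ∇X`»); a colimit cofan `inj_c : P_c → X_ℂ` of geometrically irreducible complex varieties and a family `inj'_{c'} : P'_{c'} → Y_ℂ`
of geometrically irreducible complex varieties.  HYPOTHESIS `hlift`: any two complex points of one piece `P_c` are the images under
`u_ℂ` of two complex points of one piece `P'_{c'}`.  CONCLUSION: every `P : Spec ℂ → ∇X` over `k` factors as `Q ≫ ν`.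
Proof in the module docstring (tree `Nabla.exists_mem_range_tensorHom_baseChange_complex` + §2 + `∇X ↪ X × X` mono).  With
`Albanese.epi_map_of_nablaMap_surjective_algPoints` ∕ `Sec42Data.epi_Atr_of_nablaTr_surjective_algPoints` this is the surjectivity of
`Alb_u` used in the proof of [Liu2021, Thm. 4.18 (1)] for the transition morphisms `u^{K'}_K` of the tower (l. 2064 «generically finite
dominant»). [cite: Liu2021, §2.1 Def. 2.1 (1) (l. 1171–1176), proof of the Proposition (l. 1194–1200), §4.2 l. 2060–2072]
[cite: GortzWedhorn2020, Prop. 4.16] -/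
theorem exists_comp_eq_of_pieces_lift [CharZero k] {d : ℕ} {X Y : SchemeOver k} [SmoothOfRelativeDimension d X.hom]
    (hX : IsProjectiveOver X) (N : Nabla X) (N' : Nabla Y) (u : Y ⟶ X) (ν : N'.N ⟶ N.N)
    (hν : ν ≫ N.incl = N'.incl ≫ (u ⊗ₘ u))
    {κ κ' : Type} {P : κ → SchemeOver ℂ} {P' : κ' → SchemeOver ℂ}
    (inj : ∀ c, P c ⟶ (bcFunctor k ℂ).obj X) [∀ c, GeometricallyIrreducible (P c).hom]
    (hcol : IsColimit (Cofan.mk ((bcFunctor k ℂ).obj X) inj))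
    (inj' : ∀ c', P' c' ⟶ (bcFunctor k ℂ).obj Y) [∀ c', GeometricallyIrreducible (P' c').hom]
    (hlift : ∀ (c : κ) (z₁ z₂ : ComplexPoints (P c)), ∃ (c' : κ') (z₁' z₂' : ComplexPoints (P' c')),
      AlgPoints.map (inj' c' ≫ (bcFunctor k ℂ).map u) z₁' = AlgPoints.map (inj c) z₁ ∧
        AlgPoints.map (inj' c' ≫ (bcFunctor k ℂ).map u) z₂' = AlgPoints.map (inj c) z₂) :
    ∀ Pt : AlgPoints N.N ℂ, ∃ Q : AlgPoints N'.N ℂ, Q ≫ ν = Pt := by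
  intro Pt
  -- notation: `e Z Q` = the `ℂ`-point of `Z_ℂ` attached to `Q : Spec ℂ → Z` over `k`
  set e : ∀ Z : SchemeOver k, AlgPoints Z ℂ → ComplexPoints ((bcFunctor k ℂ).obj Z) :=
    fun Z Q => AlgPoints.baseChangeEquiv (algebraMap k ℂ) Z Q with he
  have e_comp : ∀ {Z W : SchemeOver k} (g : Z ⟶ W) (Q : AlgPoints Z ℂ), e W (Q ≫ g) = e Z Q ≫ (bcFunctor k ℂ).map g :=
    fun g Q => AlgPoints.baseChangeEquiv_comp g Q
  -- §A  both coordinates of `Pt` lie in one piece `P_c`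
  obtain ⟨c, hc⟩ := exists_mem_range_tensorHom_baseChange_complex (d := d) hX N inj hcol (e N.N Pt).pt
  rw [← AlgPoints.pt_map, AlgPoints.map_apply, ← e_comp, mem_range_tensorHom_μ_iff'] at hc
  obtain ⟨h₁, h₂⟩ := hc
  rw [← AlgPoints.pt_map, AlgPoints.map_apply, ← e_comp, Category.assoc] at h₁ h₂
  haveI : ∀ c, IsOpenImmersion (inj c).left := fun c => isOpenImmersion_left_of_isColimit hcol c
  obtain ⟨z₁, hz₁⟩ := AlgPoints.exists_comp_eq_of_pt_mem_range (inj c) _ h₁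
  obtain ⟨z₂, hz₂⟩ := AlgPoints.exists_comp_eq_of_pt_mem_range (inj c) _ h₂
  -- §B  lift them to one piece `P'_{c'}`
  obtain ⟨c', z₁', z₂', hz₁', hz₂'⟩ := hlift c z₁ z₂
  simp only [AlgPoints.map_apply] at hz₁' hz₂'
  rw [hz₁] at hz₁'
  rw [hz₂] at hz₂'
  -- §C  the lifted pair `w' = (x', y')` of `(Y × Y)_ℂ` lies in `(∇Y)_ℂ`: a `ℂ`-point `Qb` of `(∇Y)_ℂ`
  set w' : ComplexPoints ((bcFunctor k ℂ).obj (Y ⊗ Y)) :=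
    lift (z₁' ≫ inj' c') (z₂' ≫ inj' c') ≫ Functor.LaxMonoidal.μ (bcFunctor k ℂ) Y Y with hw'
  have hw'mem : w'.pt ∈ Set.range ⇑((bcFunctor k ℂ).map N'.incl).left := by
    apply range_tensorHom_μ_subset_range_map_incl N' (inj' c')
    refine ⟨(lift z₁' z₂').left (IsLocalRing.closedPoint ℂ), ?_⟩
    rw [hw', ← lift_map, Category.assoc, Over.comp_left, Scheme.Hom.comp_apply]
    rfl
  haveI : IsOpenImmersion N'.incl.left := N'.isOpenImmersion_incl
  haveI := GaloisDescent.isOpenImmersion_bcFunctor_map_left ℂ N'.incl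
  obtain ⟨Qb, hQb⟩ := AlgPoints.exists_comp_eq_of_pt_mem_range ((bcFunctor k ℂ).map N'.incl) w' hw'mem
  -- §D  `Q := Qb` read over `k`; `Q ≫ ν = Pt` because `∇X ↪ X × X` is a monomorphism and `(·)_ℂ` is injective on points
  refine ⟨(AlgPoints.baseChangeEquiv (algebraMap k ℂ) N'.N).symm Qb, ?_⟩
  have heQ : e N'.N ((AlgPoints.baseChangeEquiv (algebraMap k ℂ) N'.N).symm Qb) = Qb := Equiv.apply_symm_apply _ _
  -- the right-hand side `e (Pt ≫ incl)` is `lift (e (Pt ≫ incl ≫ fst)) (e (Pt ≫ incl ≫ snd)) ≫ μ`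
  have hR : e (X ⊗ X) (Pt ≫ N.incl) =
      lift (e X (Pt ≫ N.incl ≫ fst X X)) (e X (Pt ≫ N.incl ≫ snd X X)) ≫ Functor.LaxMonoidal.μ (bcFunctor k ℂ) X X := by
    have hδ : e (X ⊗ X) (Pt ≫ N.incl) ≫ Functor.OplaxMonoidal.δ (bcFunctor k ℂ) X X =
        lift (e X (Pt ≫ N.incl ≫ fst X X)) (e X (Pt ≫ N.incl ≫ snd X X)) := by
      apply CartesianMonoidalCategory.hom_ext
      · rw [lift_fst, Category.assoc, Functor.OplaxMonoidal.δ_fst, ← e_comp, Category.assoc]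
      · rw [lift_snd, Category.assoc, Functor.OplaxMonoidal.δ_snd, ← e_comp, Category.assoc]
    rw [← hδ, Category.assoc, Functor.Monoidal.δ_μ, Category.comp_id]
  -- the left-hand side `e (Q ≫ incl' ≫ (u × u)) = (x', y') ≫ (u_ℂ × u_ℂ) ≫ μ` is the same pair
  have hL : e (X ⊗ X) ((AlgPoints.baseChangeEquiv (algebraMap k ℂ) N'.N).symm Qb ≫ N'.incl ≫ (u ⊗ₘ u)) =
      lift (e X (Pt ≫ N.incl ≫ fst X X)) (e X (Pt ≫ N.incl ≫ snd X X)) ≫ Functor.LaxMonoidal.μ (bcFunctor k ℂ) X X := by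
    rw [← Category.assoc, e_comp, e_comp, heQ, hQb, hw', Category.assoc, ← Functor.LaxMonoidal.μ_natural, ← Category.assoc,
      lift_map, Category.assoc, Category.assoc, hz₁', hz₂']
  rw [← cancel_mono N.incl, Category.assoc, hν, ← (AlgPoints.baseChangeEquiv (algebraMap k ℂ) (X ⊗ X)).injective.eq_iff]
  change e (X ⊗ X) _ = e (X ⊗ X) _
  exact hL.trans hR.symm

end Complex

end Nabla

/-! ## §4 The same for the transition morphisms of a §4.2 datum: `Alb_{u^{K'}_K}` is an epimorphism -/

namespace Sec42Data

open AbelianVariety (bcSpec bcFunctor)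

set_option backward.isDefEq.respectTransparency false

variable {F E : Type} [Field F] [NumberField F] [NumberField.IsTotallyReal F] [Field E] [NumberField E] [Algebra F E]
  [NumberField.IsTotallyComplex E] [Algebra.IsQuadraticExtension F E]
variable {P5 : PropC5Data F E} {isotropicAt : ℕ → Prop} (C : Sec42Data P5 isotropicAt)

/-- **`Alb_{u^{K'}_K}` is an EPIMORPHISM as soon as same-piece pairs of complex points of `X_K` lift along `u^{K'}_K` to same-piece
pairs of complex points of `X_{K'}`** (§4.2 datum `C`, `E ⊆ ℂ` by `[Algebra E ℂ]`; pieces = ANY colimit cofan of geometrically irreducible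
complex varieties for `X_K ⊗_E ℂ` and ANY geometrically irreducible family for `X_{K'} ⊗_E ℂ`).  Assembly: `X_K` is smooth of relative
dimension `n − 1` and projective (`CompactifiedSystem.smooth_X ∕ projective_X`, §4.2 l. 2064), `∇u^{K'}_K` is the restriction of
`u × u` (`Sec42Data.nablaTr_incl`), so `Nabla.exists_comp_eq_of_pieces_lift` gives the `ℂ`-point surjectivity of `∇u^{K'}_K`, and
`Sec42Data.epi_Atr_of_nablaTr_surjective_algPoints` (with `∇X_K` reduced and locally of finite type, `NablaSmooth.lean`) the
epimorphism.  In Liu's proof of Thm. 4.18 (1) this is the surjectivity of `Alb` along the tower (l. 2064 «generically finite dominant»;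
for Shimura varieties the lifting is [Deligne1979] 2.1.2–2.1.4: `[z, aK'] ↦ [z, aK]` on `⊔_g Γ_g \ X⁺`).
[cite: Liu2021, §4.2 l. 2060–2072 and Thm. 4.18 (1) proof l. 2247–2282; Def. 2.1 (1), Def. 2.3]
[cite: Deligne1979ShimuraVarieties, 2.1.2–2.1.4] -/
theorem epi_Atr_of_pieces_lift [Algebra E ℂ] {K K' : C5.SmallLevel C.S.K₀} (f : K' ⟶ K)
    {κ κ' : Type} {P : κ → SchemeOver ℂ} {P' : κ' → SchemeOver ℂ}
    (inj : ∀ c, P c ⟶ (bcFunctor E ℂ).obj (C.X K)) [∀ c, GeometricallyIrreducible (P c).hom]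
    (hcol : IsColimit (Cofan.mk ((bcFunctor E ℂ).obj (C.X K)) inj))
    (inj' : ∀ c', P' c' ⟶ (bcFunctor E ℂ).obj (C.X K')) [∀ c', GeometricallyIrreducible (P' c').hom]
    (hlift : ∀ (c : κ) (z₁ z₂ : ComplexPoints (P c)), ∃ (c' : κ') (z₁' z₂' : ComplexPoints (P' c')),
      AlgPoints.map (inj' c' ≫ (bcFunctor E ℂ).map (C.cpt.X.map f)) z₁' = AlgPoints.map (inj c) z₁ ∧
        AlgPoints.map (inj' c' ≫ (bcFunctor E ℂ).map (C.cpt.X.map f)) z₂' = AlgPoints.map (inj c) z₂) :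
    Epi (C.Atr f) := by
  haveI := C.cpt.smooth_X K
  haveI := C.isReduced_nabla_left K
  haveI := C.locallyOfFiniteType_nabla_hom K
  exact C.epi_Atr_of_nablaTr_surjective_algPoints ℂ f
    (Nabla.exists_comp_eq_of_pieces_lift (d := P5.n - 1) (C.cpt.projective_X K) (C.alb K).nabla (C.alb K').nabla
      (C.cpt.X.map f) (C.nablaTr f) (C.nablaTr_incl f) inj hcol inj' hlift)

/-- **The same with the complex pieces given on ISOMORPHIC models of `X_K ⊗_E ℂ`, `X_{K'} ⊗_E ℂ`** (e.g. the complex fibres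
`M_K ⊗_{L,τ} ℂ` of a system of models of which `X_K` is a base change; transitivity of base change): isomorphisms `e_K`, `e_{K'}` onto
`ℂ`-schemes `M_K`, `M_{K'}`, a morphism `u_M : M_{K'} → M_K` intertwined with `(u^{K'}_K)_ℂ`, a colimit cofan of geometrically
irreducible pieces of `M_K`, a geometrically irreducible family over `M_{K'}`, and the same-piece lifting along `u_M` give
`Epi (Alb_{u^{K'}_K})` — pieces and lifting are transported along `e_K⁻¹`, `e_{K'}⁻¹` (a colimit cofan stays one after composing with an
isomorphism of the apex). [cite: Liu2021, §4.2 l. 2060–2072 and Thm. 4.18 (1) proof l. 2247–2282; Def. 2.1 (1), Def. 2.3]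
[cite: GortzWedhorn2020, Prop. 4.16] -/
theorem epi_Atr_of_pieces_lift_iso [Algebra E ℂ] {K K' : C5.SmallLevel C.S.K₀} (f : K' ⟶ K)
    {MK MK' : SchemeOver ℂ} (eK : (bcFunctor E ℂ).obj (C.X K) ≅ MK) (eK' : (bcFunctor E ℂ).obj (C.X K') ≅ MK')
    (uM : MK' ⟶ MK) (hu : (bcFunctor E ℂ).map (C.cpt.X.map f) ≫ eK.hom = eK'.hom ≫ uM)
    {κ κ' : Type} {P : κ → SchemeOver ℂ} {P' : κ' → SchemeOver ℂ}
    (inj : ∀ c, P c ⟶ MK) [∀ c, GeometricallyIrreducible (P c).hom] (hcol : IsColimit (Cofan.mk MK inj))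
    (inj' : ∀ c', P' c' ⟶ MK') [∀ c', GeometricallyIrreducible (P' c').hom]
    (hlift : ∀ (c : κ) (z₁ z₂ : ComplexPoints (P c)), ∃ (c' : κ') (z₁' z₂' : ComplexPoints (P' c')),
      AlgPoints.map (inj' c' ≫ uM) z₁' = AlgPoints.map (inj c) z₁ ∧ AlgPoints.map (inj' c' ≫ uM) z₂' = AlgPoints.map (inj c) z₂) :
    Epi (C.Atr f) := by
  have hu' : eK'.inv ≫ (bcFunctor E ℂ).map (C.cpt.X.map f) = uM ≫ eK.inv := by
    rw [Iso.inv_comp_eq, ← Category.assoc, Iso.eq_comp_inv]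
    exact hu
  refine C.epi_Atr_of_pieces_lift f (fun c => inj c ≫ eK.inv) (hcol.ofIsoColimit (Cofan.ext eK.symm fun _ => rfl))
    (fun c' => inj' c' ≫ eK'.inv) fun c z₁ z₂ => ?_
  obtain ⟨c', z₁', z₂', h₁, h₂⟩ := hlift c z₁ z₂
  refine ⟨c', z₁', z₂', ?_, ?_⟩
  · rw [Category.assoc, hu', ← Category.assoc, AlgPoints.map_comp_apply, h₁, ← AlgPoints.map_comp_apply]
  · rw [Category.assoc, hu', ← Category.assoc, AlgPoints.map_comp_apply, h₂, ← AlgPoints.map_comp_apply]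

end Sec42Data

end Literature.NumberTheory.Automorphic.Liu2021.AppendixC

end
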